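import Literature.NumberTheory.Automorphic.RankinSelbergTorusEulerExact
import Literature.NumberTheory.Automorphic.RankinSelbergTorusPositivity
import HarnessLib

/-!
# The unfolded Rankin–Selberg integral at a complex point, in torus coordinates

Topic `NumberTheory/Automorphic`; namespace `Literature.NumberTheory.Automorphic`. Definitions + theorems.
`RankinSelbergTorusIntegral` treats the unfolded global Rankin–Selberg integral
`Ψ(s; W, W̄, Φ) = ∫_{(𝔸ˣ)ⁿ × K} |W(diag(a) k)|² Φ(e_n diag(a) k) |det a|^s δ_B(a)⁻¹ da dk` at a REAL
point `s = σ`, as an integral in `[0, ∞]`. For the identity `I(s; φ̄, φ, Φ) = A(s) L^S(s, π × π̃)` on the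
open half-plane `re s > 1` (Jacquet–Shalika (1981), §4; Cogdell (2004), Thm. 2.2) one needs the same
integral at a COMPLEX point `s`, as a Bochner integral. This file sets it up:

* `torusWeightC n K s a = ∏_i ‖a_i‖^{s - (n-1-2i)} = |det a|^s δ_B(a)⁻¹ ∈ ℂ` (complex powers of the
  positive reals `‖a_i‖`), with `‖torusWeightC s a‖ = torusWeight (re s) a` (`norm_torusWeightC`),
  `torusWeightC σ a = torusWeight σ a` for real `σ` (`torusWeightC_ofReal`), multiplicativity
  (`torusWeightC_mul`) and the value on `ϖ_v^μ`: `q_v^{b(μ) - s|μ|}` (`torusWeightC_localTorusPow`);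
* `torusIntegrandC n K W Φ s (a, k) = |W(diag(a) k)|² Φ(e_n diag(a) k) · torusWeightC s a ∈ ℂ`, with
  `‖torusIntegrandC s p‖ = |W|² |Φ| torusWeight (re s)` (`norm_torusIntegrandC`) and, for `Φ ≥ 0`,
  `ENNReal.ofReal ‖torusIntegrandC s p‖ = torusIntegrand (re s) p` (`ofReal_norm_torusIntegrandC`): the
  complex integrand is dominated by (indeed has modulus equal to) the real one at `σ = re s`;
* `rankinSelbergTorusIntegralC νA νK W Φ s = ∫ torusIntegrandC s d(νA × νK)` (Bochner) and the box
  integrals `∫_{B × K}`;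
* the **translation law at a good place** for complex `s` (`torusIntegrandC_localTorusPow_mul`):
  `I_s(ϖ_v^μ a, k) = |s_μ(x_v)|² q_v^{-s|μ|} I_s(a, k)` for `a` in the unit box at `v` — Shintani's formula
  contributes `q_v^{-b(μ)} |s_μ|²`, the complex Jacobian `q_v^{b(μ) - s|μ|}` — and its integrated form
  over the unit boxes (`setIntegral_smul_unitBox_eqC`), the complex counterpart of
  `setLIntegral_smul_unitBox_eq`.

## References

* H. Jacquet, J. A. Shalika, *On Euler products and the classification of automorphic
  representations I*, Amer. J. Math. 103 (1981), §2, §4 [JacquetShalikaAJM1981].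
* J. W. Cogdell, *Analytic theory of L-functions for GL_n*, in *An Introduction to the Langlands
  Program* (2004), §2.3 Thm. 2.2, §3 Thm. 3.3 [CogdellAnalyticTheory2004].
-/

noncomputable section

open MeasureTheory Measure NumberField IsDedekindDomain Matrix Set Filter Finset
open scoped MatrixGroups ENNReal NNReal ComplexConjugate Pointwise
open Literature.RingTheory.SymmetricFunctions.SymmPoly
open Literature.NumberTheory.GaloisRepresentations (ideleGroup localUnits)

namespace Literature.NumberTheory.Automorphic

/-! ### The complex torus weight -/

section Weight

variable (n : ℕ) (K : Type) [Field K] [NumberField K]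

/-- The **complex torus weight** `∏_i ‖a_i‖^{s - (n - 1 - 2 i)} = |det a|^s · δ_B(a)⁻¹ ∈ ℂ` of a
diagonal torus element `a = diag(a_0, …, a_{n-1})` at a complex point `s` (principal complex powers
of the positive reals `‖a_i‖`; for real `s = σ` this is `torusWeight n K σ a`). [folklore] -/
def torusWeightC (s : ℂ) (a : Fin n → ideleGroup K) : ℂ :=
  ∏ i : Fin n, (((IdeleClassGroup.ideleNorm K (a i) : ℝ≥0) : ℝ) : ℂ) ^
    (s - ((((n : ℝ) - 1 - 2 * (i : ℕ) : ℝ)) : ℂ))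

variable {n K}

/-- **The modulus of the complex torus weight is the real torus weight at `re s`.** [folklore] -/
theorem norm_torusWeightC (s : ℂ) (a : Fin n → ideleGroup K) :
    ‖torusWeightC n K s a‖ = torusWeight n K s.re a := by
  unfold torusWeightC torusWeight
  rw [norm_prod]
  refine Finset.prod_congr rfl fun i _ => ?_
  rw [Complex.norm_cpow_eq_rpow_re_of_pos (ideleNorm_coe_pos (K := K) (a i)), Complex.sub_re, Complex.ofReal_re]

/-- At a real point the complex torus weight is the real one. [folklore] -/
theorem torusWeightC_ofReal (σ : ℝ) (a : Fin n → ideleGroup K) :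
    torusWeightC n K (σ : ℂ) a = (torusWeight n K σ a : ℂ) := by
  unfold torusWeightC torusWeight
  rw [Complex.ofReal_prod]
  refine Finset.prod_congr rfl fun i _ => ?_
  rw [← Complex.ofReal_sub, ← Complex.ofReal_cpow (NNReal.coe_nonneg _)]

/-- The complex torus weight is multiplicative. [folklore] -/
theorem torusWeightC_mul (s : ℂ) (t a : Fin n → ideleGroup K) :
    torusWeightC n K s (t * a) = torusWeightC n K s t * torusWeightC n K s a := by
  unfold torusWeightC
  rw [← Finset.prod_mul_distrib]
  refine Finset.prod_congr rfl fun i _ => ?_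
  rw [Pi.mul_apply, map_mul, NNReal.coe_mul, Complex.ofReal_mul,
    Complex.mul_cpow_ofReal_nonneg (NNReal.coe_nonneg _) (NNReal.coe_nonneg _)]

variable {v : HeightOneSpectrum (𝓞 K)} {ϖ : (v.adicCompletion K)ˣ}

/-- `q ^ z` for the residue cardinality as an exponential (the base is a positive real).
[folklore] -/
theorem residueCard_cpow_eq_exp (z : ℂ) :
    (v.residueCard : ℂ) ^ z = Complex.exp (Real.log (v.residueCard : ℝ) * z) := by
  have hq : (0 : ℝ) < v.residueCard := by exact_mod_cast zero_lt_one.trans v.one_lt_residueCard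
  have hq0 : (v.residueCard : ℂ) ≠ 0 := by exact_mod_cast hq.ne'
  rw [Complex.cpow_def_of_ne_zero hq0, ← Complex.ofReal_natCast, ← Complex.ofReal_log hq.le]

/-- `∑_i -(μ_i (s - (n-1-2i))) = b(μ) - s |μ|` with `b = torusExponent`, complex form.
[folklore] -/
theorem sum_neg_mul_weightExponentC (s : ℂ) (mu : Fin n → ℕ) :
    ∑ i : Fin n, -((mu i : ℂ) * (s - ((((n : ℝ) - 1 - 2 * (i : ℕ) : ℝ)) : ℂ))) =
      (torusExponent mu : ℂ) - s * ∑ i, (mu i : ℂ) := by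
  simp only [torusExponent, Int.cast_sum, Int.cast_mul, Int.cast_natCast, Int.cast_sub, Int.cast_one,
    Int.cast_ofNat, Finset.mul_sum, ← Finset.sum_sub_distrib]
  refine Finset.sum_congr rfl fun i _ => ?_
  push_cast
  ring

/-- **The complex torus weight of `ϖ_v^μ`**: `|det ϖ^μ|^s δ_B(ϖ^μ)⁻¹ = q_v^{b(μ) - s|μ|}`. [folklore] -/
theorem torusWeightC_localTorusPow (hϖ : Valued.v (ϖ : v.adicCompletion K) = WithZero.exp (-1 : ℤ))
    (s : ℂ) (mu : Fin n → ℕ) :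
    torusWeightC n K s (localTorusPow ϖ mu) =
      (v.residueCard : ℂ) ^ ((torusExponent mu : ℂ) - s * ∑ i, (mu i : ℂ)) := by
  have hq : (0 : ℝ) < v.residueCard := by exact_mod_cast zero_lt_one.trans v.one_lt_residueCard
  unfold torusWeightC
  have hfac : ∀ i : Fin n,
      (((IdeleClassGroup.ideleNorm K (localTorusPow ϖ mu i) : ℝ≥0) : ℝ) : ℂ) ^
          (s - ((((n : ℝ) - 1 - 2 * (i : ℕ) : ℝ)) : ℂ)) =
        Complex.exp (Real.log (v.residueCard : ℝ) *
          -((mu i : ℂ) * (s - ((((n : ℝ) - 1 - 2 * (i : ℕ) : ℝ)) : ℂ)))) := by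
    intro i
    have him : (((Real.log (v.residueCard : ℝ) : ℝ) : ℂ) * (((-(mu i : ℝ) : ℝ)) : ℂ)).im = 0 := by
      rw [← Complex.ofReal_mul, Complex.ofReal_im]
    have hL : ((v.residueCard : ℝ) : ℂ) ^ (((-(mu i : ℝ)) : ℝ) : ℂ) =
        Complex.exp (((Real.log (v.residueCard : ℝ) : ℝ) : ℂ) * (((-(mu i : ℝ) : ℝ)) : ℂ)) := by
      rw [Complex.cpow_def_of_ne_zero (by exact_mod_cast hq.ne'), ← Complex.ofReal_log hq.le]
    rw [ideleNorm_localTorusPow hϖ, ← Real.rpow_natCast, Real.inv_rpow hq.le, ← Real.rpow_neg hq.le,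
      Complex.ofReal_cpow hq.le, hL, Complex.cpow_def_of_ne_zero (Complex.exp_ne_zero _),
      Complex.log_exp (by rw [him]; exact neg_lt_zero.2 Real.pi_pos) (by rw [him]; exact Real.pi_pos.le)]
    congr 1
    push_cast
    ring
  rw [Finset.prod_congr rfl fun i _ => hfac i, ← Complex.exp_sum, ← Finset.mul_sum,
    sum_neg_mul_weightExponentC, residueCard_cpow_eq_exp]

end Weight

/-! ### The complex integrand and the Bochner torus integral -/

section Integrand

variable (n : ℕ) (K : Type) [Field K] [NumberField K]

/-- The **integrand of the unfolded Rankin–Selberg integral at a complex point** in torus coordinates: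
`(a, k) ↦ |W(diag(a) k)|² Φ(e_n diag(a) k) |det a|^s δ_B(a)⁻¹ ∈ ℂ`. [folklore] -/
def torusIntegrandC (W : GL (Fin n) (AdeleRing (𝓞 K) K) → ℂ) (Φ : (Fin n → AdeleRing (𝓞 K) K) → ℝ)
    (s : ℂ) (p : (Fin n → ideleGroup K) × ↥(maximalCompactAdelic n K)) : ℂ :=
  ((‖W (torusPoint n K p)‖ ^ 2 * Φ (lastRow n K (torusPoint n K p)) : ℝ) : ℂ) * torusWeightC n K s p.1

variable [MeasurableSpace (ideleGroup K)] [MeasurableSpace (AdelicGroupData.gl n K).Adelic]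

/-- **The unfolded Rankin–Selberg integral at a complex point `s`, in torus coordinates**:
`Ψ(s; W, W̄, Φ) = ∫_{(𝔸ˣ)ⁿ × K} |W(diag(a) k)|² Φ(e_n diag(a) k) |det a|^s δ_B(a)⁻¹ dνA(a) dνK(k)`, a
Bochner integral (value `0` when not integrable; it is integrable exactly when the real integral
`rankinSelbergTorusIntegral νA νK W Φ (re s)` is finite, `integrable_torusIntegrandC_iff`). This is
`Ψ(s; W, W̄, Φ)` of Jacquet–Shalika (1981), §4 / Cogdell (2004), Thm. 2.2, written through the
Iwasawa decomposition. [cite: CogdellAnalyticTheory2004, §2.3, Thm. 2.2] -/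
def rankinSelbergTorusIntegralC (νA : Measure (Fin n → ideleGroup K))
    (νK : Measure ↥(maximalCompactAdelic n K)) (W : GL (Fin n) (AdeleRing (𝓞 K) K) → ℂ)
    (Φ : (Fin n → AdeleRing (𝓞 K) K) → ℝ) (s : ℂ) : ℂ :=
  ∫ p, torusIntegrandC n K W Φ s p ∂(νA.prod νK)

variable {n K}
variable {W : GL (Fin n) (AdeleRing (𝓞 K) K) → ℂ} {Φ : (Fin n → AdeleRing (𝓞 K) K) → ℝ}

omit [MeasurableSpace (ideleGroup K)] [MeasurableSpace (AdelicGroupData.gl n K).Adelic] in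
/-- **The modulus of the complex integrand**: `‖I_s(a, k)‖ = |W|² |Φ| · |det a|^{re s} δ_B(a)⁻¹`.
[folklore] -/
theorem norm_torusIntegrandC (s : ℂ) (p : (Fin n → ideleGroup K) × ↥(maximalCompactAdelic n K)) :
    ‖torusIntegrandC n K W Φ s p‖ =
      ‖W (torusPoint n K p)‖ ^ 2 * |Φ (lastRow n K (torusPoint n K p))| * torusWeight n K s.re p.1 := by
  rw [torusIntegrandC, norm_mul, norm_torusWeightC, Complex.norm_real, Real.norm_eq_abs, abs_mul,
    abs_of_nonneg (sq_nonneg _)]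

omit [MeasurableSpace (ideleGroup K)] [MeasurableSpace (AdelicGroupData.gl n K).Adelic] in
/-- For `Φ ≥ 0` the modulus of the complex integrand at `s` **is** the real integrand at `re s`.
[folklore] -/
theorem ofReal_norm_torusIntegrandC (hΦ : ∀ y, 0 ≤ Φ y) (s : ℂ)
    (p : (Fin n → ideleGroup K) × ↥(maximalCompactAdelic n K)) :
    ENNReal.ofReal ‖torusIntegrandC n K W Φ s p‖ = torusIntegrand n K W Φ s.re p := by
  rw [norm_torusIntegrandC, abs_of_nonneg (hΦ _), torusIntegrand]

omit [MeasurableSpace (ideleGroup K)] [MeasurableSpace (AdelicGroupData.gl n K).Adelic] in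
/-- At a real point the complex integrand is the real one: `I_σ(p) = ofReal (…)` with
`torusIntegrand σ p = ENNReal.ofReal (re (I_σ p))`. [folklore] -/
theorem torusIntegrandC_ofReal (σ : ℝ) (p : (Fin n → ideleGroup K) × ↥(maximalCompactAdelic n K)) :
    torusIntegrandC n K W Φ (σ : ℂ) p =
      ((‖W (torusPoint n K p)‖ ^ 2 * Φ (lastRow n K (torusPoint n K p)) * torusWeight n K σ p.1 : ℝ) : ℂ) := by
  rw [torusIntegrandC, torusWeightC_ofReal, ← Complex.ofReal_mul]

/-- **Integrability of the complex integrand** is finiteness of the real torus integral at `re s`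
(for `Φ ≥ 0` and an a.e. strongly measurable integrand). [folklore] -/
theorem integrable_torusIntegrandC_iff (νA : Measure (Fin n → ideleGroup K))
    (νK : Measure ↥(maximalCompactAdelic n K)) (hΦ : ∀ y, 0 ≤ Φ y) {s : ℂ}
    (hm : AEStronglyMeasurable (torusIntegrandC n K W Φ s) (νA.prod νK)) :
    Integrable (torusIntegrandC n K W Φ s) (νA.prod νK) ↔
      rankinSelbergTorusIntegral n K νA νK W Φ s.re ≠ ⊤ := by
  rw [Integrable, and_iff_right hm, hasFiniteIntegral_iff_norm, rankinSelbergTorusIntegral, lt_top_iff_ne_top]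
  simp_rw [ofReal_norm_torusIntegrandC hΦ]

end Integrand

/-! ### Translation by `ϖ_v^μ` at a complex point -/

section Translation

variable {n : ℕ} {K : Type} [Field K] [NumberField K] {v : HeightOneSpectrum (𝓞 K)}
  {ϖ : (v.adicCompletion K)ˣ} {x : Fin n → ℂ}
  {W : GL (Fin n) (AdeleRing (𝓞 K) K) → ℂ} {Φ : (Fin n → AdeleRing (𝓞 K) K) → ℝ}

/-- The **complex local Rankin–Selberg coefficient** `|s_μ(x)|² q_v^{-s|μ|}` — the term of the torus
sum `T_v(q_v^{-s})` indexed by the weight `μ`; its modulus is the real coefficient at `re s`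
(`localCoeff`). [folklore] -/
def localCoeffC (v : HeightOneSpectrum (𝓞 K)) (x : Fin n → ℂ) (s : ℂ) (mu : Fin n → ℕ) : ℂ :=
  ((‖schurTrunc x mu‖ ^ 2 : ℝ) : ℂ) * (v.residueCard : ℂ) ^ (-(s * ∑ i, (mu i : ℂ)))

/-- **The modulus of the complex local coefficient is the real one at `re s`.** [folklore] -/
theorem ofReal_norm_localCoeffC (v : HeightOneSpectrum (𝓞 K)) (x : Fin n → ℂ) (s : ℂ) (mu : Fin n → ℕ) :
    ENNReal.ofReal ‖localCoeffC v x s mu‖ = localCoeff v x s.re mu := by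
  have hq : (0 : ℝ) < v.residueCard := by exact_mod_cast zero_lt_one.trans v.one_lt_residueCard
  rw [localCoeffC, localCoeff, norm_mul, Complex.norm_real, Real.norm_of_nonneg (sq_nonneg _),
    ← Complex.ofReal_natCast, Complex.norm_cpow_eq_rpow_re_of_pos hq]
  congr 2
  simp only [Complex.neg_re, Complex.mul_re, Complex.re_sum, Complex.natCast_re, Complex.im_sum,
    Complex.natCast_im, Finset.sum_const_zero, mul_zero, sub_zero]

/-- **The complex integrand on the translate `ϖ_v^μ · a` of a point `a` of the unit box.** If `W` is an
unramified Whittaker–Hecke datum at `v` with parameters `x` and `Φ` is spherical at `v`, then for `a`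
with unit entries at `v` and `k ∈ K`, `I_s(ϖ^μ a, k) = |s_μ(x)|² q_v^{-s|μ|} · I_s(a, k)`: Shintani's
formula contributes `q_v^{-b(μ)} |s_μ(x)|²` to `|W|²`, the complex Jacobian `|det|^s δ_B⁻¹`
contributes `q_v^{b(μ) - s|μ|}`, and `Φ(e_n ·)` does not change (Jacquet–Shalika (1981), §2;
Cogdell (2004), proof of Thm. 3.3). [folklore] -/
theorem torusIntegrandC_localTorusPow_mul (hW : IsTorusUnramifiedAt n K W v ϖ x)
    (hΦ : IsLastRowSphericalAt n K Φ v) (s : ℂ) (mu : Fin n → ℕ) {a : Fin n → ideleGroup K}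
    (ha : ∀ i, Valued.v (((a i : ideleGroup K) : AdeleRing (𝓞 K) K).2 v) = 1)
    (k : ↥(maximalCompactAdelic n K)) :
    torusIntegrandC n K W Φ s (localTorusPow ϖ mu * a, k) =
      localCoeffC v x s mu * torusIntegrandC n K W Φ s (a, k) := by
  have hq : (0 : ℝ) < v.residueCard := by exact_mod_cast zero_lt_one.trans v.one_lt_residueCard
  have hq0 : ((v.residueCard : ℝ) : ℂ) ≠ 0 := by exact_mod_cast hq.ne'
  set g := torusPoint n K (a, k) with hg
  have hpt : torusPoint n K (localTorusPow ϖ mu * a, k) = GLn.ofLocal n K v (piPowGL ϖ.ne_zero mu) * g := by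
    rw [torusPoint_mul, glDiagonal_localTorusPow]
  -- Shintani
  have hW' : W (torusPoint n K (localTorusPow ϖ mu * a, k)) =
      (((Real.sqrt (v.residueCard : ℝ) : ℝ) : ℂ)) ^ (-torusExponent mu) * schurTrunc x mu * W g := by
    rw [hpt]
    exact hW.apply_ofLocal_piPowGL_mul (localComponent_torusPoint_mem_glInt ha k) mu
  -- `Φ(e_n ·)` is unchanged
  have hΦ' : Φ (lastRow n K (torusPoint n K (localTorusPow ϖ mu * a, k))) = Φ (lastRow n K g) := by
    rw [torusPoint_mul, lastRow_glDiagonal_mul]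
    obtain ⟨h1, h2, m, h3⟩ := lastEntry_localTorusPow (n := n) ϖ mu
    refine hΦ.smul_eq _ _ h1 h2 ?_ ?_ (valued_lastRow_torusPoint_le_one ha k)
    · rw [h3, Units.val_pow_eq_pow_val, map_pow, hW.valued_eq, ← WithZero.exp_nsmul, ← WithZero.exp_zero,
        WithZero.exp_le_exp]
      simp
    · rw [h3]
      exact Units.ne_zero _
  -- the complex Jacobian
  have hwt : torusWeightC n K s (localTorusPow ϖ mu * a) =
      (v.residueCard : ℂ) ^ ((torusExponent mu : ℂ) - s * ∑ i, (mu i : ℂ)) * torusWeightC n K s a := by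
    rw [torusWeightC_mul, torusWeightC_localTorusPow hW.valued_eq]
  -- combine the powers of `q_v`
  have hpow : (((v.residueCard : ℝ) ^ (-torusExponent mu) : ℝ) : ℂ) *
      (v.residueCard : ℂ) ^ ((torusExponent mu : ℂ) - s * ∑ i, (mu i : ℂ)) =
        (v.residueCard : ℂ) ^ (-(s * ∑ i, (mu i : ℂ))) := by
    rw [Complex.ofReal_zpow, Complex.ofReal_natCast, ← Complex.cpow_intCast,
      ← Complex.cpow_add _ _ (by exact_mod_cast hq.ne')]
    congr 1
    push_cast
    ring
  simp only [torusIntegrandC, localCoeffC]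
  rw [← hg, hW', hΦ', hwt, norm_sqrt_zpow_mul_mul_sq hq]
  push_cast
  calc ((v.residueCard : ℂ) ^ (-torusExponent mu) * ((‖schurTrunc x mu‖ : ℂ) ^ 2 * (‖W g‖ : ℂ) ^ 2) *
        (Φ (lastRow n K g) : ℂ) *
        ((v.residueCard : ℂ) ^ ((torusExponent mu : ℂ) - s * ∑ i, (mu i : ℂ)) * torusWeightC n K s a))
      = ((((v.residueCard : ℝ) ^ (-torusExponent mu) : ℝ) : ℂ) *
          (v.residueCard : ℂ) ^ ((torusExponent mu : ℂ) - s * ∑ i, (mu i : ℂ))) *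
          ((‖schurTrunc x mu‖ : ℂ) ^ 2 * ((‖W g‖ : ℂ) ^ 2 * (Φ (lastRow n K g) : ℂ) * torusWeightC n K s a)) := by
        push_cast; ring
    _ = (‖schurTrunc x mu‖ : ℂ) ^ 2 * (v.residueCard : ℂ) ^ (-(s * ∑ i, (mu i : ℂ))) *
          ((‖W g‖ : ℂ) ^ 2 * (Φ (lastRow n K g) : ℂ) * torusWeightC n K s a) := by rw [hpow]; ring

end Translation

/-! ### The complex torus sum and the Euler factorisation at a complex point -/

section EulerC

variable {n : ℕ} {K : Type} [Field K] [NumberField K]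

/-- The **complex torus sum** `T_v(q_v^{-s}) = ∑_μ |s_μ(x)|² q_v^{-s|μ|}` (unconditional `tsum`; it
converges absolutely as soon as the real torus sum `T_v(q_v^{-re s}) = schurSelfSum x (q_v^{-re s})` is
finite, `summable_localCoeffC`). [folklore] -/
def torusSumC (v : HeightOneSpectrum (𝓞 K)) (x : Fin n → ℂ) (s : ℂ) : ℂ := ∑' mu : Fin n → ℕ, localCoeffC v x s mu

/-- **Absolute convergence of the complex torus sum** from finiteness of the real one at `re s`.
[folklore] -/
theorem summable_localCoeffC {v : HeightOneSpectrum (𝓞 K)} {x : Fin n → ℂ} {s : ℂ}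
    (hT : schurSelfSum x ((v.residueCard : ℝ) ^ (-s.re)) ≠ ⊤) :
    Summable fun mu : Fin n → ℕ => localCoeffC v x s mu := by
  refine Summable.of_norm ?_
  have h : ∀ mu, ‖localCoeffC v x s mu‖ = (localCoeff v x s.re mu).toReal := fun mu => by
    rw [← ofReal_norm_localCoeffC, ENNReal.toReal_ofReal (norm_nonneg _)]
  simp_rw [h]
  refine ENNReal.summable_toReal ?_
  rwa [tsum_localCoeff]

variable [MeasurableSpace (ideleGroup K)] [BorelSpace (ideleGroup K)]

-- the house local instances of `RankinSelbergTorusIntegral` (Borel structure of `GL_n(𝔸_K)`, second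
-- countability of `𝔸_Kˣ` for the Borel structure of the finite product `(𝔸_Kˣ)ⁿ`); none overrides a
-- Mathlib instance
attribute [local instance] adelicBorel borelSpace_adelic locallyCompactSpace_adelic
  secondCountableTopology_gl_adelic secondCountableTopology_ideleGroup

variable (νA : Measure (Fin n → ideleGroup K)) [νA.IsMulLeftInvariant] [SFinite νA]
  (νK : Measure ↥(maximalCompactAdelic n K)) [SFinite νK]

variable {v : HeightOneSpectrum (𝓞 K)} {ϖ : (v.adicCompletion K)ˣ} {x : Fin n → ℂ}
  {W : GL (Fin n) (AdeleRing (𝓞 K) K) → ℂ} {Φ : (Fin n → AdeleRing (𝓞 K) K) → ℝ}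

/-- **The complex integral over a translate of the unit box.** Translating the torus variable by
`ϖ_v^μ` multiplies the Bochner integral of the complex integrand over `B × K`, `B` the unit box at `v`
and `G`, by `|s_μ(x)|² q_v^{-s|μ|}` (left invariance of the Haar measure of the torus and
`torusIntegrandC_localTorusPow_mul`; no integrability needed). [folklore] -/
theorem setIntegral_smul_unitBox_eqC (hW : IsTorusUnramifiedAt n K W v ϖ x)
    (hΦ : IsLastRowSphericalAt n K Φ v) (s : ℂ) (G : Set (HeightOneSpectrum (𝓞 K))) (mu : Fin n → ℕ) :
    ∫ p in (localTorusPow ϖ mu • unitBox (insert v G)) ×ˢ Set.univ, torusIntegrandC n K W Φ s p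
        ∂(νA.prod νK) =
      localCoeffC v x s mu *
        ∫ p in unitBox (insert v G) ×ˢ Set.univ, torusIntegrandC n K W Φ s p ∂(νA.prod νK) := by
  set t := localTorusPow (n := n) ϖ mu with ht
  set B := unitBox (n := n) (K := K) (insert v G) with hB
  let e : (Fin n → ideleGroup K) × ↥(maximalCompactAdelic n K) ≃ᵐ
      (Fin n → ideleGroup K) × ↥(maximalCompactAdelic n K) :=
    (MeasurableEquiv.mulLeft t).prodCongr (MeasurableEquiv.refl _)
  have he : ⇑e = Prod.map (t * ·) id := rfl
  have hmp : MeasurePreserving e (νA.prod νK) (νA.prod νK) := by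
    rw [he]
    exact (measurePreserving_mul_left νA t).prod (MeasurePreserving.id νK)
  have hpre : e ⁻¹' ((t • B) ×ˢ Set.univ) = B ×ˢ Set.univ := by
    ext p
    simp only [he, Set.mem_preimage, Set.mem_prod, Set.mem_univ, and_true, Prod.map_fst]
    exact Set.smul_mem_smul_set_iff
  calc ∫ p in (t • B) ×ˢ Set.univ, torusIntegrandC n K W Φ s p ∂(νA.prod νK)
      = ∫ p in e ⁻¹' ((t • B) ×ˢ Set.univ), torusIntegrandC n K W Φ s (e p) ∂(νA.prod νK) :=
        (hmp.setIntegral_preimage_emb e.measurableEmbedding _ _).symm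
    _ = ∫ p in B ×ˢ Set.univ, torusIntegrandC n K W Φ s (t * p.1, p.2) ∂(νA.prod νK) := by
        rw [hpre]
        rfl
    _ = ∫ p in B ×ˢ Set.univ, localCoeffC v x s mu * torusIntegrandC n K W Φ s p ∂(νA.prod νK) := by
        refine setIntegral_congr_fun ((measurableSet_unitBox _).prod MeasurableSet.univ) fun p hp => ?_
        exact torusIntegrandC_localTorusPow_mul hW hΦ s mu (fun i => hp.1 v (Set.mem_insert v G) i) p.2
    _ = localCoeffC v x s mu * ∫ p in B ×ˢ Set.univ, torusIntegrandC n K W Φ s p ∂(νA.prod νK) :=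
        integral_const_mul _ _

omit [MeasurableSpace (ideleGroup K)] [BorelSpace (ideleGroup K)] in
/-- **The complex integrand vanishes where the real one does**: on the unit box off `G ∌ v`, off the
translates `ϖ_v^μ B(insert v G)` (`torusIntegrand_eq_zero_of_not_mem_iUnion` at `σ = re s`, for
`Φ ≥ 0`). [folklore] -/
theorem torusIntegrandC_eq_zero_of_not_mem_iUnion (hn : 0 < n) (hW : IsTorusUnramifiedAt n K W v ϖ x)
    (hWZ : ∀ (z : ideleGroup K) (g : GL (Fin n) (AdeleRing (𝓞 K) K)),
      ‖W (Matrix.GeneralLinearGroup.scalar (Fin n) z * g)‖ = ‖W g‖)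
    (hΦv : ∀ y : Fin n → AdeleRing (𝓞 K) K, Φ y ≠ 0 → ∀ j, Valued.v ((y j).2 v) ≤ 1)
    (hΦ0 : ∀ y, 0 ≤ Φ y) (s : ℂ) {G : Set (HeightOneSpectrum (𝓞 K))} (hv : v ∉ G)
    {a : Fin n → ideleGroup K} (ha : a ∈ unitBox (n := n) (K := K) G) (k : ↥(maximalCompactAdelic n K))
    (hnot : a ∉ ⋃ mu : Fin n → ℕ, localTorusPow ϖ mu • unitBox (n := n) (K := K) (insert v G)) :
    torusIntegrandC n K W Φ s (a, k) = 0 := by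
  have h := torusIntegrand_eq_zero_of_not_mem_iUnion hn hW hWZ hΦv s.re hv ha k hnot
  rw [← ofReal_norm_torusIntegrandC hΦ0, ENNReal.ofReal_eq_zero] at h
  exact norm_le_zero_iff.1 h

/-- **One exact Euler factor at a complex point.** For `v ∉ G`, `W` an unramified Whittaker–Hecke datum
at `v` with `‖W‖` central-invariant, `Φ ≥ 0` spherical at `v` and supported on `v`-integral rows, and
the complex integrand integrable on `B(G) × K`:
`∑_μ |s_μ(x)|² q_v^{-s|μ|} · ∫_{B(insert v G) × K} I_s` converges to `∫_{B(G) × K} I_s`. [folklore] -/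
theorem hasSum_localCoeffC_mul_setIntegral (hn : 0 < n) (hW : IsTorusUnramifiedAt n K W v ϖ x)
    (hWZ : ∀ (z : ideleGroup K) (g : GL (Fin n) (AdeleRing (𝓞 K) K)),
      ‖W (Matrix.GeneralLinearGroup.scalar (Fin n) z * g)‖ = ‖W g‖)
    (hΦ : IsLastRowSphericalAt n K Φ v)
    (hΦv : ∀ y : Fin n → AdeleRing (𝓞 K) K, Φ y ≠ 0 → ∀ j, Valued.v ((y j).2 v) ≤ 1)
    (hΦ0 : ∀ y, 0 ≤ Φ y) (s : ℂ) {G : Set (HeightOneSpectrum (𝓞 K))} (hv : v ∉ G)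
    (hint : IntegrableOn (torusIntegrandC n K W Φ s) (unitBox G ×ˢ Set.univ) (νA.prod νK)) :
    HasSum (fun mu : Fin n → ℕ => localCoeffC v x s mu *
        ∫ p in unitBox (insert v G) ×ˢ Set.univ, torusIntegrandC n K W Φ s p ∂(νA.prod νK))
      (∫ p in unitBox G ×ˢ Set.univ, torusIntegrandC n K W Φ s p ∂(νA.prod νK)) := by
  have hUm : ∀ mu : Fin n → ℕ, MeasurableSet ((localTorusPow ϖ mu • unitBox (n := n) (K := K) (insert v G)) ×ˢ
      (Set.univ : Set ↥(maximalCompactAdelic n K))) := fun mu =>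
    (measurableSet_smul_unitBox _ _).prod MeasurableSet.univ
  have hdisj : Pairwise (Function.onFun Disjoint fun mu : Fin n → ℕ =>
      (localTorusPow ϖ mu • unitBox (n := n) (K := K) (insert v G)) ×ˢ
        (Set.univ : Set ↥(maximalCompactAdelic n K))) := fun mu mu' hne =>
    Set.disjoint_prod.2 (Or.inl (pairwise_disjoint_localTorusPow_smul_unitBox hW.valued_eq G hne))
  have hSM : MeasurableSet (unitBox (n := n) (K := K) G ×ˢ (Set.univ : Set ↥(maximalCompactAdelic n K))) :=
    (measurableSet_unitBox _).prod MeasurableSet.univ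
  have hsub : (⋃ mu : Fin n → ℕ, (localTorusPow ϖ mu • unitBox (n := n) (K := K) (insert v G)) ×ˢ
      (Set.univ : Set ↥(maximalCompactAdelic n K))) ⊆ unitBox G ×ˢ Set.univ :=
    Set.iUnion_subset fun mu => Set.prod_mono (localTorusPow_smul_unitBox_subset hv mu) subset_rfl
  -- the integral over `B(G) × K` is the integral over the union of the translates
  have heq : ∫ p in unitBox G ×ˢ Set.univ, torusIntegrandC n K W Φ s p ∂(νA.prod νK) =
      ∫ p in ⋃ mu : Fin n → ℕ, (localTorusPow ϖ mu • unitBox (n := n) (K := K) (insert v G)) ×ˢ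
        (Set.univ : Set ↥(maximalCompactAdelic n K)), torusIntegrandC n K W Φ s p ∂(νA.prod νK) := by
    refine setIntegral_eq_of_subset_of_forall_sdiff_eq_zero hSM hsub ?_
    rintro ⟨a, k⟩ ⟨⟨haB, -⟩, hpU⟩
    refine torusIntegrandC_eq_zero_of_not_mem_iUnion hn hW hWZ hΦv hΦ0 s hv haB k fun hmem => hpU ?_
    obtain ⟨mu, hmu⟩ := Set.mem_iUnion.1 hmem
    exact Set.mem_iUnion.2 ⟨mu, Set.mk_mem_prod hmu (Set.mem_univ _)⟩
  rw [heq]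
  simp_rw [← setIntegral_smul_unitBox_eqC νA νK hW hΦ s G]
  exact hasSum_integral_iUnion hUm hdisj (hint.mono_set hsub)

/-- **One exact Euler factor at a complex point, closed form**: with `T_v(q_v^{-s}) = torusSumC v x s`,
`T_v(q_v^{-s}) · ∫_{B(insert v G) × K} I_s = ∫_{B(G) × K} I_s` (the series `∑_μ |s_μ|² q_v^{-s|μ|} · ∫_{B'}`
converges to the right side; `tsum_mul_right` is unconditional in `ℂ`). [folklore] -/
theorem torusSumC_mul_setIntegral_eq (hn : 0 < n) (hW : IsTorusUnramifiedAt n K W v ϖ x)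
    (hWZ : ∀ (z : ideleGroup K) (g : GL (Fin n) (AdeleRing (𝓞 K) K)),
      ‖W (Matrix.GeneralLinearGroup.scalar (Fin n) z * g)‖ = ‖W g‖)
    (hΦ : IsLastRowSphericalAt n K Φ v)
    (hΦv : ∀ y : Fin n → AdeleRing (𝓞 K) K, Φ y ≠ 0 → ∀ j, Valued.v ((y j).2 v) ≤ 1)
    (hΦ0 : ∀ y, 0 ≤ Φ y) (s : ℂ) {G : Set (HeightOneSpectrum (𝓞 K))} (hv : v ∉ G)
    (hint : IntegrableOn (torusIntegrandC n K W Φ s) (unitBox G ×ˢ Set.univ) (νA.prod νK)) :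
    torusSumC v x s * ∫ p in unitBox (insert v G) ×ˢ Set.univ, torusIntegrandC n K W Φ s p ∂(νA.prod νK) =
      ∫ p in unitBox G ×ˢ Set.univ, torusIntegrandC n K W Φ s p ∂(νA.prod νK) := by
  rw [← (hasSum_localCoeffC_mul_setIntegral νA νK hn hW hWZ hΦ hΦv hΦ0 s hv hint).tsum_eq, tsum_mul_right,
    torusSumC]

variable {ϖ : ∀ v : HeightOneSpectrum (𝓞 K), (v.adicCompletion K)ˣ}
  {x : HeightOneSpectrum (𝓞 K) → Fin n → ℂ}

/-- **The exact Euler factorisation on the unit boxes at a complex point.** For every finite `F ⊆ Good`: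
`(∏_{v ∈ F} T_v(q_v^{-s})) · ∫_{B(Good) × K} I_s = ∫_{B(Good ∖ F) × K} I_s` (induction on `F`).
[cite: JacquetShalikaAJM1981, §2 Prop. (2.3), §4] -/
theorem prod_torusSumC_mul_setIntegral_eq (hn : 0 < n) {Good : Set (HeightOneSpectrum (𝓞 K))}
    (hW : ∀ v ∈ Good, IsTorusUnramifiedAt n K W v (ϖ v) (x v))
    (hWZ : ∀ (z : ideleGroup K) (g : GL (Fin n) (AdeleRing (𝓞 K) K)),
      ‖W (Matrix.GeneralLinearGroup.scalar (Fin n) z * g)‖ = ‖W g‖)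
    (hΦ : ∀ v ∈ Good, IsLastRowSphericalAt n K Φ v)
    (hΦv : ∀ v ∈ Good, ∀ y : Fin n → AdeleRing (𝓞 K) K, Φ y ≠ 0 → ∀ j, Valued.v ((y j).2 v) ≤ 1)
    (hΦ0 : ∀ y, 0 ≤ Φ y) (s : ℂ) (hint : Integrable (torusIntegrandC n K W Φ s) (νA.prod νK))
    (F : Finset (HeightOneSpectrum (𝓞 K))) (hF : (↑F : Set (HeightOneSpectrum (𝓞 K))) ⊆ Good) :
    (∏ v ∈ F, torusSumC v (x v) s) *
        ∫ p in unitBox Good ×ˢ Set.univ, torusIntegrandC n K W Φ s p ∂(νA.prod νK) =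
      ∫ p in unitBox (Good \ ↑F) ×ˢ Set.univ, torusIntegrandC n K W Φ s p ∂(νA.prod νK) := by
  classical
  induction F using Finset.induction_on with
  | empty => simp
  | insert v F hvF ih =>
    have hv : v ∈ Good := hF (Finset.mem_coe.2 (Finset.mem_insert_self v F))
    have hF' : (↑F : Set (HeightOneSpectrum (𝓞 K))) ⊆ Good := fun w hw =>
      hF (Finset.mem_coe.2 (Finset.mem_insert_of_mem (Finset.mem_coe.1 hw)))
    rw [Finset.prod_insert hvF, mul_assoc, ih hF']
    have hset : Good \ ↑F = insert v (Good \ ↑(insert v F)) := by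
      ext w
      by_cases hw : w = v
      · subst hw
        simp [hv, hvF]
      · simp [hw]
    rw [hset]
    exact torusSumC_mul_setIntegral_eq νA νK hn (hW v hv) hWZ (hΦ v hv) (hΦv v hv) hΦ0 s (by simp)
      hint.integrableOn

/-- **The exact Euler factorisation of the unfolded Rankin–Selberg integral at a complex point over a
finite set of unramified places**: `(∏_{v ∈ F} T_v(q_v^{-s})) · ∫_{B(F) × K} I_s = Ψ(s)`, the full
Bochner torus integral `rankinSelbergTorusIntegralC νA νK W Φ s` (Jacquet–Shalika (1981), §2 Prop. (2.3)
and §4; Cogdell (2004), Thm. 2.2 with Thm. 3.3).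
[cite: JacquetShalikaAJM1981, §2 Prop. (2.3), §4] [cite: CogdellAnalyticTheory2004, Thm. 2.2, Thm. 3.3] -/
theorem prod_torusSumC_mul_setIntegral_eq_rankinSelbergTorusIntegralC (hn : 0 < n)
    (F : Finset (HeightOneSpectrum (𝓞 K)))
    (hW : ∀ v ∈ F, IsTorusUnramifiedAt n K W v (ϖ v) (x v))
    (hWZ : ∀ (z : ideleGroup K) (g : GL (Fin n) (AdeleRing (𝓞 K) K)),
      ‖W (Matrix.GeneralLinearGroup.scalar (Fin n) z * g)‖ = ‖W g‖)
    (hΦ : ∀ v ∈ F, IsLastRowSphericalAt n K Φ v)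
    (hΦv : ∀ v ∈ F, ∀ y : Fin n → AdeleRing (𝓞 K) K, Φ y ≠ 0 → ∀ j, Valued.v ((y j).2 v) ≤ 1)
    (hΦ0 : ∀ y, 0 ≤ Φ y) (s : ℂ) (hint : Integrable (torusIntegrandC n K W Φ s) (νA.prod νK)) :
    (∏ v ∈ F, torusSumC v (x v) s) *
        ∫ p in unitBox (↑F : Set (HeightOneSpectrum (𝓞 K))) ×ˢ Set.univ, torusIntegrandC n K W Φ s p
          ∂(νA.prod νK) =
      rankinSelbergTorusIntegralC n K νA νK W Φ s := by
  rw [prod_torusSumC_mul_setIntegral_eq νA νK hn (Good := ↑F) (fun v hv => hW v (Finset.mem_coe.1 hv)) hWZ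
    (fun v hv => hΦ v (Finset.mem_coe.1 hv)) (fun v hv => hΦv v (Finset.mem_coe.1 hv)) hΦ0 s hint F subset_rfl,
    Set.sdiff_self, unitBox_empty, Set.univ_prod_univ, Measure.restrict_univ]
  rfl

end EulerC

/-! ### The complex torus sum in closed form (Cauchy's identity at `y = x̄`) -/

section CauchyC

variable {n : ℕ} {K : Type} [Field K] [NumberField K] {v : HeightOneSpectrum (𝓞 K)} {x : Fin n → ℂ}

/-- **Cauchy's identity for `∑_μ |s_μ(x)|² t^{|μ|}` at a complex `t`.** If `‖x_i x̄_j t‖ < 1` for all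
`i, j` and the family `μ ↦ |s_μ(x)|² t^{|μ|}` is summable, then
`∑_μ |s_μ(x)|² t^{|μ|} = ∏_{i,j} (1 - x_i x̄_j t)⁻¹` (`hasSum_shintaniPair` for the pair `(s, s̄)` and the
parameters `(x, x̄)`, regrouped fibrewise over `|μ| = N`; Macdonald (1995), Ch. I (4.3)).
[cite: Macdonald1995, Ch. I (4.3)] -/
theorem hasSum_normSq_schurTrunc_mul_pow {t : ℂ} (ht : ∀ i j, ‖x i * conj (x j) * t‖ < 1)
    (hsum : Summable fun mu : Fin n → ℕ => ((‖schurTrunc x mu‖ ^ 2 : ℝ) : ℂ) * t ^ (∑ i, mu i)) :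
    HasSum (fun mu : Fin n → ℕ => ((‖schurTrunc x mu‖ ^ 2 : ℝ) : ℂ) * t ^ (∑ i, mu i))
      (∏ i, ∏ j, (1 - x i * conj (x j) * t)⁻¹) := by
  classical
  obtain ⟨S, hS⟩ := hsum
  -- Cauchy's identity, summed over `N = |μ|`
  have hC := hasSum_shintaniPair x (conj ∘ x) (schurTrunc x) (conj ∘ schurTrunc x)
    (fun ν hν => schurTrunc_of_not_antitone x hν) (schurTrunc_pieri x)
    (fun ν hν => by simp [schurTrunc_of_not_antitone x hν]) (pieri_conj (schurTrunc_pieri x))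
    (fun i j => by simpa only [Function.comp_apply] using ht i j)
  rw [schurTrunc_zero, Function.comp_apply, schurTrunc_zero, map_one, one_mul, one_mul] at hC
  -- the fibrewise sums of our family are the terms of Cauchy's series
  have hfib := hS.tsum_fiberwise fun mu : Fin n → ℕ => ∑ i, mu i
  have hterm : ∀ N : ℕ, ∑' mu : ((fun mu : Fin n → ℕ => ∑ i, mu i) ⁻¹' {N}),
      ((‖schurTrunc x (mu : Fin n → ℕ)‖ ^ 2 : ℝ) : ℂ) * t ^ (∑ i, (mu : Fin n → ℕ) i) =
        (∑ m ∈ piAntidiag univ N, schurTrunc x m * (conj ∘ schurTrunc x) m) * t ^ N := by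
    intro N
    have hset : ((fun mu : Fin n → ℕ => ∑ i, mu i) ⁻¹' {N}) = ↑(piAntidiag (univ : Finset (Fin n)) N) := by
      ext mu
      simp [mem_piAntidiag]
    rw [tsum_congr_set_coe (fun mu : Fin n → ℕ => ((‖schurTrunc x mu‖ ^ 2 : ℝ) : ℂ) * t ^ (∑ i, mu i)) hset,
      Finset.tsum_subtype' (piAntidiag (univ : Finset (Fin n)) N)
        (fun mu : Fin n → ℕ => ((‖schurTrunc x mu‖ ^ 2 : ℝ) : ℂ) * t ^ (∑ i, mu i)), Finset.sum_mul]
    refine Finset.sum_congr rfl fun m hm => ?_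
    rw [(mem_piAntidiag.1 hm).1, Function.comp_apply, Complex.mul_conj']
    push_cast
    ring
  simp_rw [hterm] at hfib
  have hSC : S = ∏ i, ∏ j, (1 - x i * (conj ∘ x) j * t)⁻¹ := hfib.unique hC
  rw [hSC] at hS
  simpa only [Function.comp_apply] using hS

/-- **The complex torus sum in closed form.** If the real torus sum `T_v(q_v^{-re s})` is finite, then
`T_v(q_v^{-s}) = ∑_μ |s_μ(x)|² q_v^{-s|μ|} = ∏_{i,j} (1 - x_i x̄_j q_v^{-s})⁻¹ = det(1 - q_v^{-s} A ⊗ Ā)⁻¹`,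
`A = diag(x)` — the unramified local Rankin–Selberg factor `L(s, π_v × π̃_v)` for Satake parameters `x`
(Jacquet–Shalika (1981), §2 Prop. (2.3); Cogdell (2004), Thm. 3.3). [cite: JacquetShalikaAJM1981, §2 Prop. (2.3)] -/
theorem torusSumC_eq_prod_inv {s : ℂ} (hT : schurSelfSum x ((v.residueCard : ℝ) ^ (-s.re)) ≠ ⊤) :
    torusSumC v x s = ∏ i, ∏ j, (1 - x i * conj (x j) * (v.residueCard : ℂ) ^ (-s))⁻¹ := by
  have hq : (0 : ℝ) < v.residueCard := by exact_mod_cast zero_lt_one.trans v.one_lt_residueCard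
  have hq0 : (v.residueCard : ℂ) ≠ 0 := by exact_mod_cast hq.ne'
  -- the terms: `q^{-s|μ|} = (q^{-s})^{|μ|}`
  have hterm : ∀ mu : Fin n → ℕ, localCoeffC v x s mu =
      ((‖schurTrunc x mu‖ ^ 2 : ℝ) : ℂ) * ((v.residueCard : ℂ) ^ (-s)) ^ (∑ i, mu i) := by
    intro mu
    rw [localCoeffC, ← Complex.cpow_nat_mul, Nat.cast_sum]
    congr 2
    ring
  -- `‖x_i x̄_j q^{-s}‖ < 1` from the finiteness of the real torus sum at `re s`
  have hnorm : ‖(v.residueCard : ℂ) ^ (-s)‖ = (v.residueCard : ℝ) ^ (-s.re) := by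
    rw [← Complex.ofReal_natCast, Complex.norm_cpow_eq_rpow_re_of_pos hq, Complex.neg_re]
  have ht : ∀ i j, ‖x i * conj (x j) * (v.residueCard : ℂ) ^ (-s)‖ < 1 := fun i j => by
    rw [norm_mul, norm_mul, Complex.norm_conj, hnorm]
    exact norm_mul_norm_mul_lt_one_of_schurSelfSum_ne_top x (Real.rpow_nonneg hq.le _) hT i j
  have hsum : Summable fun mu : Fin n → ℕ =>
      ((‖schurTrunc x mu‖ ^ 2 : ℝ) : ℂ) * ((v.residueCard : ℂ) ^ (-s)) ^ (∑ i, mu i) :=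
    (summable_localCoeffC hT).congr hterm
  rw [torusSumC, tsum_congr hterm, (hasSum_normSq_schurTrunc_mul_pow ht hsum).tsum_eq]

/-- **… and as the inverse of the Satake pair polynomial**: if `x` enumerates the multiset `α`, then
`T_v(q_v^{-s}) = (P_{α, ᾱ}(q_v^{-s}))⁻¹` with `P_{α,β}(X) = ∏_{a ∈ α, b ∈ β} (1 - a b X)`
(`satakePairPolynomial`), the local factor of `partialPairL` for the pair `(α, conjFamily α)`.
[cite: JacquetShalikaAJM1981, §2 Prop. (2.3)] -/
theorem torusSumC_eq_inv_eval_satakePairPolynomial {s : ℂ}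
    (hT : schurSelfSum x ((v.residueCard : ℝ) ^ (-s.re)) ≠ ⊤) {α : Multiset ℂ}
    (hx : (univ : Finset (Fin n)).val.map x = α) :
    torusSumC v x s = ((satakePairPolynomial α (α.map conj)).eval ((v.residueCard : ℂ) ^ (-s)))⁻¹ := by
  have hR : (satakePairPolynomial α (α.map conj)).eval ((v.residueCard : ℂ) ^ (-s)) =
      ∏ i, ∏ j, (1 - x i * conj (x j) * (v.residueCard : ℂ) ^ (-s)) := by
    subst hx
    rw [satakePairPolynomial, Polynomial.eval_multiset_prod, Multiset.map_map,
      Multiset.prod_map_product_eq_prod_prod, Multiset.map_map, Finset.prod_eq_multiset_prod]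
    congr 1
    refine Multiset.map_congr rfl fun i _ => ?_
    simp only [Function.comp_apply, Multiset.map_map]
    rw [Finset.prod_eq_multiset_prod]
    congr 1
    refine Multiset.map_congr rfl fun j _ => ?_
    simp only [Polynomial.eval_sub, Polynomial.eval_one, Polynomial.eval_mul, Polynomial.eval_C,
      Polynomial.eval_X]
  rw [torusSumC_eq_prod_inv hT, hR]
  simp only [Finset.prod_inv_distrib]

end CauchyC

end Literature.NumberTheory.Automorphic
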